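import Summits.AtomisticToContinuum.FouriersLaw.Theorems.PhononMeanFreePathIncoherentBoundedCorrelationDecay
import Summits.AtomisticToContinuum.FouriersLaw.Theorems.BondHeatUncertaintySubdiffusiveBondHeatGibbsMomentumFourthMoment
import Summits.AtomisticToContinuum.FouriersLaw.Theses.PhononMeanFreePath
import Mathlib.Analysis.SpecialFunctions.ImproperIntegrals

/-!
# `PhononMeanFreePath.IncoherentBounded` — the fixed-`N` half and the `N`-uniform pointwise bounds

Part 2 of the support lemmas for item `stmt-AtomisticToContinuum-11815` (support, route `PhononMeanFreePath`,
sub-problem `FouriersLaw`; notation as in `PhononMeanFreePathIncoherentBoundedCorrelationDecay`: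
`r_N(t) = ∫ p₀ (K_t p_N) dμ₀`, `C_N(t) = ∫ p₀² (K_t p_N²) dμ₀ - (∫ p₀² dμ₀)(∫ K_t p_N² dμ₀)`,
`a_N = N (γ²/T²) ∫_{t>0} [C_N - 2 r_N²]`, for the `(N+1)`-site pinned anharmonic chain at equal bath temperatures):

* `cum_integrableOn`, `cum_exp_decay` — the cumulant channel `t ↦ C_N(t) - 2 r_N(t)²` is integrable on `(0,∞)`
  and decays exponentially at EVERY `N` (so no term `a_N` is a Bochner junk value; the crux `IncoherentChannel`
  forces this, `IncoherentChannel.Negative.LoadBearing.eventually_integrableOn_of_crux`);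
* `seq_eq_sub` — the two-channel split `a_N = N(γ²/T²)∫C_N - 2(γ²/T²)·N∫r_N²` holds unconditionally;
* `abs_seq_le`, `incoherentBounded_fixedN` — `|a_N| ≤ N (γ²/T²) C_N / c_N` with the fixed-`N` decay constants
  (Harris constants, NOT uniform in `N`);
* `N`-UNIFORM pointwise bounds: `abs_rN_le` (`|r_N(t)| ≤ T`), `CN_eq_kinCorr`
  (`C_N(t) = ∫ (p₀² - T) K_t(p_N² - T) dμ₀`), `abs_CN_le` (`|C_N(t)| ≤ 2T²`), `abs_cum_le` (`|C_N - 2r_N²| ≤ 4T²`),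
  from equipartition `∫ p_i² dμ_T = T`, `∫ p_i⁴ dμ_T = 3T²` (Gaussian momentum marginal at every site), Jensen and
  the kernel Gibbs invariance — the integrand of the item is bounded uniformly in `N` and `t`, so the whole
  difficulty of the item is the `N`-weighted TIME integral over `(0, ∞)`;
* `coherentDephasing_integrable` — the integrability half of the sibling crux `CoherentDephasing`
  (stmt-AtomisticToContinuum-11810), proved at every admissible parameter point.

No new definitions. (Barrier context: `Literature.Barriers.AtomisticToContinuum.FixedLengthNoConductivityControl`.)
-/

noncomputable section

open MeasureTheory ProbabilityTheory Filter Topology Set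
open scoped NNReal ENNReal
open Literature.MathematicalPhysics.KineticTheory.HeatConduction
open Literature.MathematicalPhysics.KineticTheory Literature.Probability.Process OscillatorChain
open Summit.AtomisticToContinuum.FouriersLaw.Theorems.SubdiffusiveBondHeat

namespace Summit.AtomisticToContinuum.FouriersLaw.Theorems.IncoherentBounded

/-! ## 1. The cumulant channel and the item's sequence at fixed `N` -/

section Item

variable {ω₂ lam β γ : ℝ} (hω : 0 < ω₂) (hl : 0 ≤ lam) (hβ : 0 < β) (hγ : 0 < γ) {T : ℝ} (hT : 0 < T)
include hω hl hβ hγ hT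

/-- **The cumulant channel is integrable at every `N`**: `t ↦ C_N(t) - 2 r_N(t)²` is integrable on `(0, ∞)`,
so every term `a_N` of the item's sequence is an honest Lebesgue integral (the fixed-`N` content of
`IncoherentBounded` / `IncoherentChannel`, cf. `IncoherentChannel.Negative.LoadBearing.eventually_integrableOn_of_crux`).
[cite: CuneoEckmannHairerReyBellet2018, Thm 2.13 (3)] -/
theorem cum_integrableOn (N : ℕ) :
    IntegrableOn (fun t : ℝ => ((∫ z, (z.2 0) ^ 2 * (∫ y, (y.2 (Fin.last N)) ^ 2 ∂((pinnedChain ω₂ lam β γ).transitionKernel (N + 1) T T t.toNNReal z)) ∂((pinnedChain ω₂ lam β γ).gibbsMeasure (N + 1) T)) - (∫ z, (z.2 0) ^ 2 ∂((pinnedChain ω₂ lam β γ).gibbsMeasure (N + 1) T)) * (∫ z, (∫ y, (y.2 (Fin.last N)) ^ 2 ∂((pinnedChain ω₂ lam β γ).transitionKernel (N + 1) T T t.toNNReal z)) ∂((pinnedChain ω₂ lam β γ).gibbsMeasure (N + 1) T))) - 2 * (∫ z, z.2 0 * (∫ y, y.2 (Fin.last N) ∂((pinnedChain ω₂ lam β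 γ).transitionKernel (N + 1) T T t.toNNReal z)) ∂((pinnedChain ω₂ lam β γ).gibbsMeasure (N + 1) T)) ^ 2) (Set.Ioi 0) :=
  (CN_integrableOn hω hl hβ hγ hT N).sub ((rN_sq_integrableOn hω hl hβ hγ hT N).const_mul 2)

/-- **The item's sequence splits into the two channels at every `N`** (no hypothesis):
`a_N = N(γ²/T²)∫C_N - 2(γ²/T²)·N∫r_N²`. [folklore] -/
theorem seq_eq_sub (N : ℕ) :
    (N : ℝ) * (γ ^ 2 / T ^ 2) * ∫ t in Set.Ioi (0 : ℝ), (((∫ z, (z.2 0) ^ 2 * (∫ y, (y.2 (Fin.last N)) ^ 2 ∂((pinnedChain ω₂ lam β γ).transitionKernel (N + 1) T T t.toNNReal z)) ∂((pinnedChain ω₂ lam β γ).gibbsMeasure (N + 1) T)) - (∫ z, (z.2 0) ^ 2 ∂((pinnedChain ω₂ lam β γ).gibbsMeasure (N + 1) T)) * (∫ z, (∫ y, (y.2 (Fin.last N)) ^ 2 ∂((pinnedChain ω₂ lam β γ).transitionKernel (N + 1) T T t.toNNReal z)) ∂((pinnedChain ω₂ lam β γ).gibbsMeasure (N + 1) T)))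 - 2 * (∫ z, z.2 0 * (∫ y, y.2 (Fin.last N) ∂((pinnedChain ω₂ lam β γ).transitionKernel (N + 1) T T t.toNNReal z)) ∂((pinnedChain ω₂ lam β γ).gibbsMeasure (N + 1) T)) ^ 2) =
      (N : ℝ) * (γ ^ 2 / T ^ 2) * (∫ t in Set.Ioi (0 : ℝ), ((∫ z, (z.2 0) ^ 2 * (∫ y, (y.2 (Fin.last N)) ^ 2 ∂((pinnedChain ω₂ lam β γ).transitionKernel (N + 1) T T t.toNNReal z)) ∂((pinnedChain ω₂ lam β γ).gibbsMeasure (N + 1) T)) - (∫ z, (z.2 0) ^ 2 ∂((pinnedChain ω₂ lam β γ).gibbsMeasure (N + 1) T)) * (∫ z, (∫ y, (y.2 (Fin.last N)) ^ 2 ∂((pinnedChain ω₂ lam β γ).transitionKernel (N + 1) T T t.toNNReal z)) ∂((pinnedChain ω₂ lam β γ).gibbsMeasure (N + 1) T)))) -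
        2 * (γ ^ 2 / T ^ 2) * ((N : ℝ) * ∫ t in Set.Ioi (0 : ℝ), (∫ z, z.2 0 * (∫ y, y.2 (Fin.last N) ∂((pinnedChain ω₂ lam β γ).transitionKernel (N + 1) T T t.toNNReal z)) ∂((pinnedChain ω₂ lam β γ).gibbsMeasure (N + 1) T)) ^ 2) := by
  rw [integral_sub (CN_integrableOn hω hl hβ hγ hT N) ((rN_sq_integrableOn hω hl hβ hγ hT N).const_mul 2),
    integral_const_mul]
  ring

omit hω hl hβ in
/-- **Fixed-`N` finiteness with the rate made explicit**: if `|C_N - 2r_N²| ≤ C e^{-ct}` on `t > 0` with `c > 0`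
then `|a_N| ≤ N (γ²/T²) · C / c`. The item `IncoherentBounded` is exactly an `N`-UNIFORM bound of this kind
(`N · C_N / c_N = O(1)`), which Harris-type constants do not provide. [folklore] -/
theorem abs_seq_le (N : ℕ) {C c : ℝ} (hc : 0 < c)
    (hb : ∀ t : ℝ, 0 < t → |((∫ z, (z.2 0) ^ 2 * (∫ y, (y.2 (Fin.last N)) ^ 2 ∂((pinnedChain ω₂ lam β γ).transitionKernel (N + 1) T T t.toNNReal z)) ∂((pinnedChain ω₂ lam β γ).gibbsMeasure (N + 1) T)) - (∫ z, (z.2 0) ^ 2 ∂((pinnedChain ω₂ lam β γ).gibbsMeasure (N + 1) T)) * (∫ z, (∫ y, (y.2 (Fin.last N)) ^ 2 ∂((pinnedChain ω₂ lam β γ).transitionKernel (N + 1) T T t.toNNReal z)) ∂((pinnedChain ω₂ lam β γ).gibbsMeasure (N + 1) T))) - 2 * (∫ z, z.2 0 * (∫ y, y.2 (Fin.last N) ∂((pinnedChain ω₂ lam β γ).transitionKernel (N + 1) T T t.toNNReal z)) ∂((pinnedChain ω₂ lam β γ).gibbsMeasure (N + 1) T)) ^ 2| ≤ C * Real.exp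 (-c * t)) :
    |(N : ℝ) * (γ ^ 2 / T ^ 2) * ∫ t in Set.Ioi (0 : ℝ), (((∫ z, (z.2 0) ^ 2 * (∫ y, (y.2 (Fin.last N)) ^ 2 ∂((pinnedChain ω₂ lam β γ).transitionKernel (N + 1) T T t.toNNReal z)) ∂((pinnedChain ω₂ lam β γ).gibbsMeasure (N + 1) T)) - (∫ z, (z.2 0) ^ 2 ∂((pinnedChain ω₂ lam β γ).gibbsMeasure (N + 1) T)) * (∫ z, (∫ y, (y.2 (Fin.last N)) ^ 2 ∂((pinnedChain ω₂ lam β γ).transitionKernel (N + 1) T T t.toNNReal z)) ∂((pinnedChain ω₂ lam β γ).gibbsMeasure (N + 1) T))) - 2 * (∫ z, z.2 0 * (∫ y, y.2 (Fin.last N) ∂((pinnedChain ω₂ lam β γ).transitionKernel (N + 1) T T t.toNNReal z)) ∂((pinnedChain ω₂ lam β γ).gibbsMeasure (N + 1) T)) ^ 2)| ≤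
      (N : ℝ) * (γ ^ 2 / T ^ 2) * (C / c) := by
  have hI : ∫ t in Set.Ioi (0 : ℝ), C * Real.exp (-c * t) = C / c := by
    rw [integral_const_mul, integral_exp_mul_Ioi (by linarith : -c < 0) 0, mul_zero, Real.exp_zero]
    field_simp
  have hle : |∫ t in Set.Ioi (0 : ℝ), (((∫ z, (z.2 0) ^ 2 * (∫ y, (y.2 (Fin.last N)) ^ 2 ∂((pinnedChain ω₂ lam β γ).transitionKernel (N + 1) T T t.toNNReal z)) ∂((pinnedChain ω₂ lam β γ).gibbsMeasure (N + 1) T)) - (∫ z, (z.2 0) ^ 2 ∂((pinnedChain ω₂ lam β γ).gibbsMeasure (N + 1) T)) * (∫ z, (∫ y, (y.2 (Fin.last N)) ^ 2 ∂((pinnedChain ω₂ lam β γ).transitionKernel (N + 1) T T t.toNNReal z)) ∂((pinnedChain ω₂ lam β γ).gibbsMeasure (N + 1) T))) - 2 * (∫ z, z.2 0 * (∫ y, y.2 (Fin.last N) ∂((pinnedChain ω₂ lam β γ).transitionKernel (N + 1) T T t.toNNReal z)) ∂((pinnedChain ω₂ lam β γ).gibbsMeasure (N + 1) T)) ^ 2)|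 ≤ C / c := by
    rw [← hI, ← Real.norm_eq_abs]
    refine norm_integral_le_of_norm_le ((exp_neg_integrableOn_Ioi 0 hc).const_mul C) ?_
    refine (ae_restrict_iff' measurableSet_Ioi).2 (Eventually.of_forall fun t ht => ?_)
    rw [Real.norm_eq_abs]
    exact hb t ht
  rw [abs_mul, abs_of_nonneg (by positivity : (0 : ℝ) ≤ (N : ℝ) * (γ ^ 2 / T ^ 2))]
  exact mul_le_mul_of_nonneg_left hle (by positivity)

/-- The cumulant channel decays exponentially at fixed size: `|C_N(t) - 2 r_N(t)²| ≤ C_N e^{-c_N t}` (`t ≥ 0`).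
[cite: CuneoEckmannHairerReyBellet2018, Thm 2.13 (3)] -/
theorem cum_exp_decay (N : ℕ) :
    ∃ C c : ℝ, 0 < c ∧ ∀ t : ℝ, 0 ≤ t → |((∫ z, (z.2 0) ^ 2 * (∫ y, (y.2 (Fin.last N)) ^ 2 ∂((pinnedChain ω₂ lam β γ).transitionKernel (N + 1) T T t.toNNReal z)) ∂((pinnedChain ω₂ lam β γ).gibbsMeasure (N + 1) T)) - (∫ z, (z.2 0) ^ 2 ∂((pinnedChain ω₂ lam β γ).gibbsMeasure (N + 1) T)) * (∫ z, (∫ y, (y.2 (Fin.last N)) ^ 2 ∂((pinnedChain ω₂ lam β γ).transitionKernel (N + 1) T T t.toNNReal z)) ∂((pinnedChain ω₂ lam β γ).gibbsMeasure (N + 1) T))) - 2 * (∫ z, z.2 0 * (∫ y, y.2 (Fin.last N) ∂((pinnedChain ω₂ lam β γ).transitionKernel (N + 1) T T t.toNNReal z)) ∂((pinnedChain ω₂ lam β γ).gibbsMeasure (N + 1) T)) ^ 2| ≤ C * Real.exp (-c * t) := by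
  obtain ⟨C₁, c₁, hc₁, hb₁⟩ := CN_exp_decay hω hl hβ hγ hT N
  obtain ⟨C₂, c₂, hc₂, hb₂⟩ := rN_exp_decay hω hl hβ hγ hT N
  have hC₁ : 0 ≤ C₁ := by
    have h := (abs_nonneg _).trans (hb₁ 0 le_rfl); simpa using h
  have hC₂ : 0 ≤ C₂ := by
    have h := (abs_nonneg _).trans (hb₂ 0 le_rfl); simpa using h
  refine ⟨C₁ + 2 * C₂ ^ 2, min c₁ c₂, lt_min hc₁ hc₂, fun t ht => ?_⟩
  have h1 := hb₁ t ht
  have h2 := hb₂ t ht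
  have he1 : Real.exp (-c₁ * t) ≤ Real.exp (-(min c₁ c₂) * t) :=
    Real.exp_le_exp.2 (by nlinarith [min_le_left c₁ c₂])
  have he2 : Real.exp (-c₂ * t) ≤ Real.exp (-(min c₁ c₂) * t) :=
    Real.exp_le_exp.2 (by nlinarith [min_le_right c₁ c₂])
  have he2' : Real.exp (-c₂ * t) ^ 2 ≤ Real.exp (-(min c₁ c₂) * t) := by
    have hle1 : Real.exp (-c₂ * t) ≤ 1 := Real.exp_le_one_iff.2 (by nlinarith)
    calc Real.exp (-c₂ * t) ^ 2 ≤ Real.exp (-c₂ * t) := by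
          rw [sq]; exact mul_le_of_le_one_left (Real.exp_pos _).le hle1
      _ ≤ _ := he2
  have hsq : (∫ z, z.2 0 * (∫ y, y.2 (Fin.last N) ∂((pinnedChain ω₂ lam β γ).transitionKernel (N + 1) T T t.toNNReal z)) ∂((pinnedChain ω₂ lam β γ).gibbsMeasure (N + 1) T)) ^ 2 ≤ (C₂ * Real.exp (-c₂ * t)) ^ 2 := by
    rw [← sq_abs]
    exact pow_le_pow_left₀ (abs_nonneg _) h2 2
  calc _ ≤ |((∫ z, (z.2 0) ^ 2 * (∫ y, (y.2 (Fin.last N)) ^ 2 ∂((pinnedChain ω₂ lam β γ).transitionKernel (N + 1) T T t.toNNReal z)) ∂((pinnedChain ω₂ lam β γ).gibbsMeasure (N + 1) T)) - (∫ z, (z.2 0) ^ 2 ∂((pinnedChain ω₂ lam β γ).gibbsMeasure (N + 1) T)) * (∫ z, (∫ y, (y.2 (Fin.last N)) ^ 2 ∂((pinnedChain ω₂ lam β γ).transitionKernel (N + 1) T T t.toNNReal z)) ∂((pinnedChain ω₂ lam β γ).gibbsMeasure (N + 1) T)))| + |2 * (∫ z, z.2 0 * (∫ y, y.2 (Fin.last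 N) ∂((pinnedChain ω₂ lam β γ).transitionKernel (N + 1) T T t.toNNReal z)) ∂((pinnedChain ω₂ lam β γ).gibbsMeasure (N + 1) T)) ^ 2| := abs_sub _ _
    _ ≤ C₁ * Real.exp (-c₁ * t) + 2 * (C₂ * Real.exp (-c₂ * t)) ^ 2 := by
        rw [abs_mul, abs_two, abs_pow, sq_abs]
        exact add_le_add h1 (by linarith)
    _ ≤ C₁ * Real.exp (-(min c₁ c₂) * t) + 2 * C₂ ^ 2 * Real.exp (-(min c₁ c₂) * t) := by
        rw [mul_pow]
        nlinarith [mul_le_mul_of_nonneg_left he1 hC₁, mul_le_mul_of_nonneg_left he2' (sq_nonneg C₂)]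
    _ = (C₁ + 2 * C₂ ^ 2) * Real.exp (-(min c₁ c₂) * t) := by ring

end Item

/-! ## 2. `N`-uniform pointwise bounds: `|r_N| ≤ T`, `|C_N| ≤ 2T²`, `|C_N - 2r_N²| ≤ 4T²` -/

section Uniform

variable {ω₂ lam β γ : ℝ} (hω : 0 < ω₂) (hl : 0 ≤ lam) (hβ : 0 < β) (hγ : 0 < γ) {T : ℝ} (hT : 0 < T)
include hω hl hβ hγ hT

omit hγ in
/-- `∫ p_i⁴ dμ_T = 3T²` at every site (Gaussian momentum marginal; the recursion
`∫ p^{k+2} e^{-H/T} = T(k+1) ∫ p^k e^{-H/T}` twice). [folklore] -/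
theorem integral_momentum_pow_four_gibbsMeasure (n : ℕ) (i : Fin n) :
    ∫ z, z.2 i ^ 4 ∂((pinnedChain ω₂ lam β γ).gibbsMeasure n T) = 3 * T ^ 2 := by
  rw [(pinnedChain ω₂ lam β γ).integral_gibbsMeasure]
  have h4 := pinnedChain_integral_momentum_pow_add_two hω hl hβ.le γ n hT i (k := 2) le_rfl
  have h2 := pinnedChain_integral_momentum_pow_add_two hω hl hβ.le γ n hT i (k := 0) (Nat.zero_le _)
  have hZ : 0 < ∫ x, (pinnedChain ω₂ lam β γ).gibbsDensity n T x :=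
    integral_exp_pos (pinnedChain_integrable_gibbsDensity hω hl hβ.le γ n hT)
  have h0 : ∫ x, x.2 i ^ 0 * (pinnedChain ω₂ lam β γ).gibbsDensity n T x =
      ∫ x, (pinnedChain ω₂ lam β γ).gibbsDensity n T x := by simp
  simp only [Nat.reduceAdd, Nat.cast_ofNat, Nat.cast_zero, zero_add, mul_one] at h4 h2
  rw [h0] at h2
  rw [h4, h2]
  field_simp
  ring

omit hγ in
/-- `∫ p_i² dμ_T = T` at every site. [folklore] -/
theorem integral_momentum_sq_gibbsMeasure (n : ℕ) (i : Fin n) :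
    ∫ z, z.2 i ^ 2 ∂((pinnedChain ω₂ lam β γ).gibbsMeasure n T) = T := by
  rw [(pinnedChain ω₂ lam β γ).integral_gibbsMeasure]
  have h2 := pinnedChain_integral_momentum_pow_add_two hω hl hβ.le γ n hT i (k := 0) (Nat.zero_le _)
  have hZ : 0 < ∫ x, (pinnedChain ω₂ lam β γ).gibbsDensity n T x :=
    integral_exp_pos (pinnedChain_integrable_gibbsDensity hω hl hβ.le γ n hT)
  simp only [Nat.cast_zero, zero_add, mul_one, pow_zero, one_mul] at h2
  rw [h2]
  field_simp

omit hγ in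
/-- `∫ (p_i² - T)² dμ_T = 2T²` at every site (`3T² - 2T² + T²`). [folklore] -/
theorem integral_kinObs_sq_gibbsMeasure (n : ℕ) (i : Fin n) :
    ∫ z, (z.2 i ^ 2 - T) ^ 2 ∂((pinnedChain ω₂ lam β γ).gibbsMeasure n T) = 2 * T ^ 2 := by
  haveI := pinnedChain_isProbabilityMeasure_gibbsMeasure hω hl hβ.le γ n hT
  have hi4 : Integrable (fun z : PhaseSpace n => z.2 i ^ 4) ((pinnedChain ω₂ lam β γ).gibbsMeasure n T) :=
    (pinnedChain ω₂ lam β γ).integrable_gibbsMeasure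
      (pinnedChain_integrable_momentum_pow_mul_gibbsDensity hω hl hβ.le γ n hT i le_rfl)
  have hi2 : Integrable (fun z : PhaseSpace n => z.2 i ^ 2) ((pinnedChain ω₂ lam β γ).gibbsMeasure n T) :=
    (pinnedChain ω₂ lam β γ).integrable_gibbsMeasure
      (pinnedChain_integrable_momentum_pow_mul_gibbsDensity hω hl hβ.le γ n hT i (by norm_num))
  have e : (fun z : PhaseSpace n => (z.2 i ^ 2 - T) ^ 2) = fun z => z.2 i ^ 4 - 2 * T * z.2 i ^ 2 + T ^ 2 := by
    funext z; ring
  have i1 : Integrable (fun z : PhaseSpace n => z.2 i ^ 4 - 2 * T * z.2 i ^ 2) ((pinnedChain ω₂ lam β γ).gibbsMeasure n T) :=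
    hi4.sub (hi2.const_mul _)
  rw [e, integral_add i1 (integrable_const _), integral_sub hi4 (hi2.const_mul _),
    integral_const_mul, integral_const, integral_momentum_pow_four_gibbsMeasure hω hl hβ hT n i,
    integral_momentum_sq_gibbsMeasure hω hl hβ hT n i]
  simp only [probReal_univ, smul_eq_mul, one_mul]
  ring

/-- **`|r_N(t)| ≤ T` uniformly in `N` and `t`**: weighted AM–GM `|∫ p₀ (K p_N)| ≤ (∫ p₀² + ∫ (K p_N)²)/2`, Jensen and
invariance `∫ (K_t p_N)² dμ₀ ≤ ∫ p_N² dμ₀ = T`. [folklore] -/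
theorem abs_rN_le (N : ℕ) (t : ℝ) :
    |∫ z, z.2 0 * (∫ y, y.2 (Fin.last N) ∂((pinnedChain ω₂ lam β γ).transitionKernel (N + 1) T T t.toNNReal z))
      ∂((pinnedChain ω₂ lam β γ).gibbsMeasure (N + 1) T)| ≤ T := by
  have hϑ0 : (0 : ℝ) < 1 / (4 * T) := by positivity
  have h2ϑ : 2 * (1 / (4 * T)) < 1 / T := by
    rw [show 2 * (1 / (4 * T)) = 1 / (2 * T) by field_simp; ring, div_lt_div_iff₀ (by positivity) hT]; nlinarith
  obtain ⟨hf2, hg2, hle⟩ := pinnedChain_integral_sq_act_le hω hl hβ hγ (Nat.succ_pos N) hT hϑ0 h2ϑ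
    (f := fun z : PhaseSpace (N + 1) => z.2 (Fin.last N)) (by fun_prop)
    (fun y => abs_momentum_le_exp hω hl hβ.le hϑ0 y (Fin.last N)) t.toNNReal
  obtain ⟨hp2, -, -⟩ := pinnedChain_integral_sq_act_le hω hl hβ hγ (Nat.succ_pos N) hT hϑ0 h2ϑ
    (f := fun z : PhaseSpace (N + 1) => z.2 0) (by fun_prop)
    (fun y => abs_momentum_le_exp hω hl hβ.le hϑ0 y 0) t.toNNReal
  have h := abs_integral_mul_le_weighted hp2 hg2 one_pos
  rw [one_mul, inv_one, one_mul, integral_momentum_sq_gibbsMeasure (γ := γ) hω hl hβ hT (N + 1) 0] at h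
  have hT' := integral_momentum_sq_gibbsMeasure (γ := γ) hω hl hβ hT (N + 1) (Fin.last N)
  linarith

/-- For continuous `f, g` dominated by `A e^{H/(4T)}`, `B e^{H/(4T)}`, `f · (K_u g)` is `μ_T`-integrable (both factors
are in `L²(μ_T)`, the second by Jensen and invariance). [folklore] -/
theorem integrable_mul_act {n : ℕ} {f g : PhaseSpace (n + 1) → ℝ} (hf : Continuous f) (hg : Continuous g) {A B : ℝ}
    (hfA : ∀ y, |f y| ≤ A * Real.exp (1 / (4 * T) * (pinnedChain ω₂ lam β γ).hamiltonian (n + 1) y))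
    (hgB : ∀ y, |g y| ≤ B * Real.exp (1 / (4 * T) * (pinnedChain ω₂ lam β γ).hamiltonian (n + 1) y)) (u : ℝ≥0) :
    Integrable (fun z => f z * ∫ y, g y ∂((pinnedChain ω₂ lam β γ).transitionKernel (n + 1) T T u z))
      ((pinnedChain ω₂ lam β γ).gibbsMeasure (n + 1) T) := by
  have hϑ0 : (0 : ℝ) < 1 / (4 * T) := by positivity
  have h2ϑ : 2 * (1 / (4 * T)) < 1 / T := by
    rw [show 2 * (1 / (4 * T)) = 1 / (2 * T) by field_simp; ring, div_lt_div_iff₀ (by positivity) hT]; nlinarith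
  obtain ⟨hf2, -, -⟩ := pinnedChain_integral_sq_act_le hω hl hβ hγ (Nat.succ_pos n) hT hϑ0 h2ϑ hf hfA u
  obtain ⟨-, hG2, -⟩ := pinnedChain_integral_sq_act_le hω hl hβ hγ (Nat.succ_pos n) hT hϑ0 h2ϑ hg hgB u
  have hGm : StronglyMeasurable fun z => ∫ y, g y ∂((pinnedChain ω₂ lam β γ).transitionKernel (n + 1) T T u z) :=
    hg.stronglyMeasurable.integral_kernel (κ := (pinnedChain ω₂ lam β γ).transitionKernel (n + 1) T T u)
  have hsum : Integrable (fun z => (f z ^ 2 +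
      (∫ y, g y ∂((pinnedChain ω₂ lam β γ).transitionKernel (n + 1) T T u z)) ^ 2) / 2)
      ((pinnedChain ω₂ lam β γ).gibbsMeasure (n + 1) T) := (hf2.add hG2).div_const 2
  refine hsum.mono' (hf.aestronglyMeasurable.mul hGm.aestronglyMeasurable) (Eventually.of_forall fun z => ?_)
  rw [Real.norm_eq_abs, abs_mul]
  nlinarith [sq_nonneg (|f z| - |∫ y, g y ∂((pinnedChain ω₂ lam β γ).transitionKernel (n + 1) T T u z)|),
    sq_abs (f z), sq_abs (∫ y, g y ∂((pinnedChain ω₂ lam β γ).transitionKernel (n + 1) T T u z))]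

/-- **The power covariance is the cross-correlation of the two boundary kinetic observables**:
`C_N(t) = ∫ (p₀² - T) · K_t(p_N² - T) dμ₀` (equipartition `∫ p_i² dμ₀ = T`, invariance, and `K_t 1 = 1`). [folklore] -/
theorem CN_eq_kinCorr (N : ℕ) (t : ℝ) :
    (∫ z, (z.2 0) ^ 2 * (∫ y, (y.2 (Fin.last N)) ^ 2 ∂((pinnedChain ω₂ lam β γ).transitionKernel (N + 1) T T t.toNNReal z)) ∂((pinnedChain ω₂ lam β γ).gibbsMeasure (N + 1) T)) - (∫ z, (z.2 0) ^ 2 ∂((pinnedChain ω₂ lam β γ).gibbsMeasure (N + 1) T)) * (∫ z, (∫ y, (y.2 (Fin.last N)) ^ 2 ∂((pinnedChain ω₂ lam β γ).transitionKernel (N + 1) T T t.toNNReal z)) ∂((pinnedChain ω₂ lam β γ).gibbsMeasure (N + 1) T)) =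
      ∫ z, (z.2 0 ^ 2 - T) * (∫ y, (y.2 (Fin.last N) ^ 2 - T) ∂((pinnedChain ω₂ lam β γ).transitionKernel (N + 1) T T t.toNNReal z))
        ∂((pinnedChain ω₂ lam β γ).gibbsMeasure (N + 1) T) := by
  set P := pinnedChain ω₂ lam β γ with hP
  set μ := P.gibbsMeasure (N + 1) T with hμ
  set κ := P.transitionKernel (N + 1) T T t.toNNReal with hκ
  haveI : IsProbabilityMeasure μ := pinnedChain_isProbabilityMeasure_gibbsMeasure hω hl hβ.le γ (N + 1) hT
  haveI : IsMarkovKernel κ := pinnedChain_isMarkovKernel_transitionKernel hω hl hβ.le hγ.le (N + 1) T T _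
  have hϑ0 : (0 : ℝ) < 1 / (4 * T) := by positivity
  have hϑ1 : 1 / (4 * T) < 1 / T := by rw [div_lt_div_iff₀ (by positivity) hT]; nlinarith
  have hsqb : ∀ (j : Fin (N + 1)) (y : PhaseSpace (N + 1)), |y.2 j ^ 2| ≤ (2 / (1 / (4 * T))) *
      Real.exp (1 / (4 * T) * P.hamiltonian (N + 1) y) := fun j y => by
    rw [abs_of_nonneg (sq_nonneg _)]; exact sq_momentum_le_exp (γ := γ) hω hl hβ.le hϑ0 y j
  -- kernel integrability of `p_N²`
  have hNκ : ∀ z, Integrable (fun y : PhaseSpace (N + 1) => y.2 (Fin.last N) ^ 2) (κ z) := fun z =>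
    integrable_of_abs_le_exp (pinnedChain_integrable_exp_mul_hamiltonian_transitionKernel hω hl hT hβ.le hγ.le
      (Nat.succ_pos N) hϑ0 hϑ1 _ z) (by fun_prop) (hsqb (Fin.last N))
  set G : PhaseSpace (N + 1) → ℝ := fun z => ∫ y, y.2 (Fin.last N) ^ 2 ∂(κ z) with hG
  have hGsub : ∀ z, (∫ y, (y.2 (Fin.last N) ^ 2 - T) ∂(κ z)) = G z - T := by
    intro z
    rw [integral_sub (hNκ z) (integrable_const T), integral_const]
    simp [probReal_univ, hG]
  -- `μ`-integrability of `p₀² G`, `G`, `p₀²`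
  have hpG : Integrable (fun z => z.2 0 ^ 2 * G z) μ :=
    integrable_mul_act hω hl hβ hγ hT (by fun_prop) (by fun_prop) (hsqb 0) (hsqb (Fin.last N)) _
  have h1G : Integrable (fun z => (1 : ℝ) * G z) μ :=
    integrable_mul_act hω hl hβ hγ hT (f := fun _ => (1 : ℝ)) continuous_const (by fun_prop) (A := 1)
      (fun y => by
        rw [abs_one, one_mul]
        exact Real.one_le_exp (mul_nonneg hϑ0.le (pinnedChain_hamiltonian_nonneg hω.le hl hβ.le γ (N + 1) y)))
      (hsqb (Fin.last N)) _
  have hGi : Integrable G μ := by simpa using h1G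
  have hp2 : Integrable (fun z : PhaseSpace (N + 1) => z.2 0 ^ 2) μ :=
    integrable_of_abs_le_exp (pinnedChain_integrable_exp_mul_hamiltonian_gibbsMeasure hω hl hβ.le γ (N + 1) hT hϑ1)
      (by fun_prop) (hsqb 0)
  -- the static values
  have hm0 : ∫ z, z.2 0 ^ 2 ∂μ = T := integral_momentum_sq_gibbsMeasure (γ := γ) hω hl hβ hT (N + 1) 0
  have hmG : ∫ z, G z ∂μ = T := by
    have h1 := mean_act_sq_momentum hω hl hβ hγ hT N (Fin.last N) t
    have h2 := integral_momentum_sq_gibbsMeasure (γ := γ) hω hl hβ hT (N + 1) (Fin.last N)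
    exact h1.trans h2
  -- expand the right-hand side
  have hexp : (fun z => (z.2 0 ^ 2 - T) * (∫ y, (y.2 (Fin.last N) ^ 2 - T) ∂(κ z))) =
      fun z => z.2 0 ^ 2 * G z - T * G z - T * z.2 0 ^ 2 + T ^ 2 := by
    funext z; rw [hGsub z]; ring
  have iTG : Integrable (fun z => T * G z) μ := hGi.const_mul T
  have iTp : Integrable (fun z : PhaseSpace (N + 1) => T * z.2 0 ^ 2) μ := hp2.const_mul T
  have iA : Integrable (fun z => z.2 0 ^ 2 * G z - T * G z) μ := hpG.sub iTG
  have iB : Integrable (fun z => z.2 0 ^ 2 * G z - T * G z - T * z.2 0 ^ 2) μ := iA.sub iTp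
  have hLHS : (∫ z, z.2 0 ^ 2 * (∫ y, y.2 (Fin.last N) ^ 2 ∂(κ z)) ∂μ) = ∫ z, z.2 0 ^ 2 * G z ∂μ := rfl
  have hG' : (∫ z, (∫ y, y.2 (Fin.last N) ^ 2 ∂(κ z)) ∂μ) = ∫ z, G z ∂μ := rfl
  rw [hexp, integral_add iB (integrable_const _), integral_sub iA iTp, integral_sub hpG iTG,
    integral_const_mul, integral_const_mul, integral_const, hm0, hLHS, hG', hmG]
  simp only [probReal_univ, smul_eq_mul, one_mul]
  ring

/-- **`|C_N(t)| ≤ 2T²` uniformly in `N` and `t`** (AM–GM on `∫ θ₀ · K_tθ_N`, Jensen + invariance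
`∫ (K_tθ_N)² ≤ ∫ θ_N² = 2T²`, and `∫ θ₀² = 2T²`). [folklore] -/
theorem abs_CN_le (N : ℕ) (t : ℝ) :
    |(∫ z, (z.2 0) ^ 2 * (∫ y, (y.2 (Fin.last N)) ^ 2 ∂((pinnedChain ω₂ lam β γ).transitionKernel (N + 1) T T t.toNNReal z)) ∂((pinnedChain ω₂ lam β γ).gibbsMeasure (N + 1) T)) - (∫ z, (z.2 0) ^ 2 ∂((pinnedChain ω₂ lam β γ).gibbsMeasure (N + 1) T)) * (∫ z, (∫ y, (y.2 (Fin.last N)) ^ 2 ∂((pinnedChain ω₂ lam β γ).transitionKernel (N + 1) T T t.toNNReal z)) ∂((pinnedChain ω₂ lam β γ).gibbsMeasure (N + 1) T))| ≤ 2 * T ^ 2 := by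
  rw [CN_eq_kinCorr hω hl hβ hγ hT N t]
  have hϑ0 : (0 : ℝ) < 1 / (4 * T) := by positivity
  have h2ϑ : 2 * (1 / (4 * T)) < 1 / T := by
    rw [show 2 * (1 / (4 * T)) = 1 / (2 * T) by field_simp; ring, div_lt_div_iff₀ (by positivity) hT]; nlinarith
  have hθb : ∀ (j : Fin (N + 1)) (y : PhaseSpace (N + 1)), |y.2 j ^ 2 - T| ≤ (2 / (1 / (4 * T)) + T) *
      Real.exp (1 / (4 * T) * (pinnedChain ω₂ lam β γ).hamiltonian (N + 1) y) := fun j y =>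
    abs_sq_momentum_sub_le_exp hω hl hβ.le hϑ0 hT.le y j
  obtain ⟨-, hg2, hle⟩ := pinnedChain_integral_sq_act_le hω hl hβ hγ (Nat.succ_pos N) hT hϑ0 h2ϑ
    (f := fun z : PhaseSpace (N + 1) => z.2 (Fin.last N) ^ 2 - T) (by fun_prop) (hθb (Fin.last N)) t.toNNReal
  obtain ⟨hp2, -, -⟩ := pinnedChain_integral_sq_act_le hω hl hβ hγ (Nat.succ_pos N) hT hϑ0 h2ϑ
    (f := fun z : PhaseSpace (N + 1) => z.2 0 ^ 2 - T) (by fun_prop) (hθb 0) t.toNNReal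
  have h := abs_integral_mul_le_weighted hp2 hg2 one_pos
  rw [one_mul, inv_one, one_mul, integral_kinObs_sq_gibbsMeasure (γ := γ) hω hl hβ hT (N + 1) 0] at h
  have hT' := integral_kinObs_sq_gibbsMeasure (γ := γ) hω hl hβ hT (N + 1) (Fin.last N)
  linarith

/-- **`|C_N(t) - 2 r_N(t)²| ≤ 4T²` uniformly in `N` and `t`**: the integrand of the item is uniformly bounded; all the
difficulty of `IncoherentBounded` is in the TIME integral over `(0, ∞)` weighted by `N`. [folklore] -/
theorem abs_cum_le (N : ℕ) (t : ℝ) :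
    |((∫ z, (z.2 0) ^ 2 * (∫ y, (y.2 (Fin.last N)) ^ 2 ∂((pinnedChain ω₂ lam β γ).transitionKernel (N + 1) T T t.toNNReal z)) ∂((pinnedChain ω₂ lam β γ).gibbsMeasure (N + 1) T)) - (∫ z, (z.2 0) ^ 2 ∂((pinnedChain ω₂ lam β γ).gibbsMeasure (N + 1) T)) * (∫ z, (∫ y, (y.2 (Fin.last N)) ^ 2 ∂((pinnedChain ω₂ lam β γ).transitionKernel (N + 1) T T t.toNNReal z)) ∂((pinnedChain ω₂ lam β γ).gibbsMeasure (N + 1) T))) - 2 * (∫ z, z.2 0 * (∫ y, y.2 (Fin.last N) ∂((pinnedChain ω₂ lam β γ).transitionKernel (N + 1) T T t.toNNReal z)) ∂((pinnedChain ω₂ lam β γ).gibbsMeasure (N + 1) T)) ^ 2| ≤ 4 * T ^ 2 := by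
  have h1 := abs_CN_le hω hl hβ hγ hT N t
  have h2 := abs_rN_le hω hl hβ hγ hT N t
  have h2' : (∫ z, z.2 0 * (∫ y, y.2 (Fin.last N) ∂((pinnedChain ω₂ lam β γ).transitionKernel (N + 1) T T t.toNNReal z)) ∂((pinnedChain ω₂ lam β γ).gibbsMeasure (N + 1) T)) ^ 2 ≤ T ^ 2 := by
    rw [← sq_abs]; exact pow_le_pow_left₀ (abs_nonneg _) h2 2
  calc _ ≤ |(∫ z, (z.2 0) ^ 2 * (∫ y, (y.2 (Fin.last N)) ^ 2 ∂((pinnedChain ω₂ lam β γ).transitionKernel (N + 1) T T t.toNNReal z)) ∂((pinnedChain ω₂ lam β γ).gibbsMeasure (N + 1) T)) - (∫ z, (z.2 0) ^ 2 ∂((pinnedChain ω₂ lam β γ).gibbsMeasure (N + 1) T)) * (∫ z, (∫ y, (y.2 (Fin.last N)) ^ 2 ∂((pinnedChain ω₂ lam β γ).transitionKernel (N + 1) T T t.toNNReal z)) ∂((pinnedChain ω₂ lam β γ).gibbsMeasure (N + 1) T))| + |2 * (∫ z, z.2 0 * (∫ y, y.2 (Fin.last N) ∂((pinnedChain ω₂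 lam β γ).transitionKernel (N + 1) T T t.toNNReal z)) ∂((pinnedChain ω₂ lam β γ).gibbsMeasure (N + 1) T)) ^ 2| := abs_sub _ _
    _ ≤ 2 * T ^ 2 + 2 * T ^ 2 := by
        rw [abs_mul, abs_two, abs_pow, sq_abs]
        exact add_le_add h1 (by linarith)
    _ = 4 * T ^ 2 := by ring

end Uniform

/-! ## 3. Consequences stated on the route's items -/

open Summit.AtomisticToContinuum.FouriersLaw.Theses.PhononMeanFreePath in
/-- **The integrability half of `CoherentDephasing`, PROVED** (first conjunct of crux stmt-AtomisticToContinuum-11810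
at every admissible parameter point): `t ↦ r_N(t)²` is integrable on `(0,∞)` for every `N`; what remains of that
crux is the limit `N ∫ r_N² → 0`. [cite: CuneoEckmannHairerReyBellet2018, Thm 2.13 (3)] -/
theorem coherentDephasing_integrable (ω₂ lam β γ : ℝ) (hω : 0 < ω₂) (hl : 0 < lam) (hβ : 0 < β) (hγ : 0 < γ)
    (T : ℝ) (hT : 0 < T) (N : ℕ) :
    IntegrableOn (fun t : ℝ => (∫ z, z.2 0 * (∫ y, y.2 (Fin.last N) ∂((pinnedChain ω₂ lam β γ).transitionKernel (N + 1) T T t.toNNReal z)) ∂((pinnedChain ω₂ lam β γ).gibbsMeasure (N + 1) T)) ^ 2) (Set.Ioi 0) :=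
  rN_sq_integrableOn hω hl.le hβ hγ hT N

open Summit.AtomisticToContinuum.FouriersLaw.Theses.PhononMeanFreePath in
/-- **Fixed-`N` finiteness of the item's sequence**: for all admissible parameters, `T > 0` and EVERY `N` there is
a finite bound `|a_N| ≤ B_N` coming from an honest integral (`B_N = N(γ²/T²) C_N/c_N` with the fixed-`N` decay
constants); `IncoherentBounded` asks for `sup_N B_N < ∞`. [cite: CuneoEckmannHairerReyBellet2018, Thm 2.13 (3)] -/
theorem incoherentBounded_fixedN (ω₂ lam β γ : ℝ) (hω : 0 < ω₂) (hl : 0 < lam) (hβ : 0 < β) (hγ : 0 < γ)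
    (T : ℝ) (hT : 0 < T) (N : ℕ) :
    ∃ C c : ℝ, 0 < c ∧ (∀ t : ℝ, 0 ≤ t → |((∫ z, (z.2 0) ^ 2 * (∫ y, (y.2 (Fin.last N)) ^ 2 ∂((pinnedChain ω₂ lam β γ).transitionKernel (N + 1) T T t.toNNReal z)) ∂((pinnedChain ω₂ lam β γ).gibbsMeasure (N + 1) T)) - (∫ z, (z.2 0) ^ 2 ∂((pinnedChain ω₂ lam β γ).gibbsMeasure (N + 1) T)) * (∫ z, (∫ y, (y.2 (Fin.last N)) ^ 2 ∂((pinnedChain ω₂ lam β γ).transitionKernel (N + 1) T T t.toNNReal z)) ∂((pinnedChain ω₂ lam β γ).gibbsMeasure (N + 1) T))) - 2 * (∫ z, z.2 0 * (∫ y, y.2 (Fin.last N) ∂((pinnedChain ω₂ lam β γ).transitionKernel (N + 1) T T t.toNNReal z)) ∂((pinnedChain ω₂ lam β γ).gibbsMeasure (N + 1) T)) ^ 2| ≤ C * Real.exp (-c * t)) ∧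
      |(N : ℝ) * (γ ^ 2 / T ^ 2) * ∫ t in Set.Ioi (0 : ℝ), (((∫ z, (z.2 0) ^ 2 * (∫ y, (y.2 (Fin.last N)) ^ 2 ∂((pinnedChain ω₂ lam β γ).transitionKernel (N + 1) T T t.toNNReal z)) ∂((pinnedChain ω₂ lam β γ).gibbsMeasure (N + 1) T)) - (∫ z, (z.2 0) ^ 2 ∂((pinnedChain ω₂ lam β γ).gibbsMeasure (N + 1) T)) * (∫ z, (∫ y, (y.2 (Fin.last N)) ^ 2 ∂((pinnedChain ω₂ lam β γ).transitionKernel (N + 1) T T t.toNNReal z)) ∂((pinnedChain ω₂ lam β γ).gibbsMeasure (N + 1) T))) - 2 * (∫ z, z.2 0 * (∫ y, y.2 (Fin.last N) ∂((pinnedChain ω₂ lam β γ).transitionKernel (N + 1) T T t.toNNReal z)) ∂((pinnedChain ω₂ lam β γ).gibbsMeasure (N + 1) T)) ^ 2)| ≤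
        (N : ℝ) * (γ ^ 2 / T ^ 2) * (C / c) := by
  obtain ⟨C, c, hc, hb⟩ := cum_exp_decay hω hl.le hβ hγ hT N
  exact ⟨C, c, hc, hb, abs_seq_le hγ hT N hc fun t ht => hb t ht.le⟩


end Summit.AtomisticToContinuum.FouriersLaw.Theorems.IncoherentBounded

end
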